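import Summits.QuantumAdvantage.AdviceFreeQNC0.WindowGapLaw
import HarnessLib

/-!
# Cell qa-qnc0 — GLOBAL JUNTAS lose a third (degree-free), from the window gap law
(planner qa-qnc0-p2 `GlobalJuntaGap.lean` frame: `GlobalJuntaThreeQuarters` was `4|J| + 3 ≤ n ⇒ #win ≤ (3/4)·2ⁿ`)

* `gapLaw_of_window_le` — `GapLaw m (2^{ℓ₀} − 2) (3·2^{ℓ₀})` for every `m ≥ 42ℓ₀` (monotonicity);
* `exists_window_disjoint_len` — pigeonhole: `J ⊆ Fin n` misses one of the `|J| + 1` windows `[mj, mj + m)`;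
* **`globalJunta_window`** — a walk strategy (any charge, any tables, any degree) all of whose cuts read only a set `J` of
  input bits with `42ℓ₀·(|J| + 1) ≤ n` wins on at most `(2/3)(1 + 2^{−ℓ₀})·2ⁿ` inputs: `3·2^{ℓ₀}·#WIN ≤ (2·2^{ℓ₀} + 2)·2ⁿ`.
  (The end bet shows `2/3` is sharp.)

WHAT THIS IS NOT: nothing on strategies reading all bits; crux 22907 / 23029 untouched; separation NOT moved.
-/

noncomputable section

namespace Summit.QuantumAdvantage.AdviceFreeQNC0

namespace TransferWalk

open Finset

/-- The window gap law for every window length `m ≥ 42ℓ₀`. -/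
theorem gapLaw_of_window_le {ℓ₀ m : ℕ} (hℓ₀ : 1 ≤ ℓ₀) (hm : 42 * ℓ₀ ≤ m) :
    GapLaw m (2 ^ ℓ₀ - 2) (3 * 2 ^ ℓ₀) :=
  gapLaw_mono hm (gapLaw_window ℓ₀ hℓ₀)

/-- Pigeonhole: `J ⊆ Fin n` misses one of the `|J| + 1` windows `[mj, mj + m)`, `j ≤ |J|`. -/
theorem exists_window_disjoint_len {n : ℕ} (m : ℕ) (J : Finset (Fin n)) :
    ∃ j : ℕ, j ≤ J.card ∧ ∀ i ∈ J, i.val < m * j ∨ m * j + m ≤ i.val := by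
  by_contra hcon
  push Not at hcon
  have hpick : ∀ j : Fin (J.card + 1), ∃ i ∈ J, m * j.val ≤ i.val ∧ i.val < m * j.val + m := by
    intro j
    obtain ⟨i, hi, h1, h2⟩ := hcon j.val (Nat.le_of_lt_succ j.isLt)
    exact ⟨i, hi, h1, h2⟩
  choose f hf using hpick
  have hinj : Function.Injective f := by
    intro j j' hjj
    have h1 := (hf j).2
    have h2 := (hf j').2
    rw [hjj] at h1
    apply Fin.ext
    by_contra hne
    rcases Nat.lt_or_gt_of_ne hne with hlt | hlt
    · have : m * j.val + m ≤ m * j'.val := by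
        rw [← Nat.mul_succ]; exact Nat.mul_le_mul_left _ (Nat.succ_le_of_lt hlt)
      omega
    · have : m * j'.val + m ≤ m * j.val := by
        rw [← Nat.mul_succ]; exact Nat.mul_le_mul_left _ (Nat.succ_le_of_lt hlt)
      omega
  have hcard := Finset.card_le_card_of_injOn (s := (univ : Finset (Fin (J.card + 1)))) (t := J) f
    (fun j _ => (hf j).1) (hinj.injOn)
  rw [card_univ, Fintype.card_fin] at hcard
  omega

/-- **Global juntas lose a third**: cuts reading only `J` with `42ℓ₀·(|J| + 1) ≤ n` win on `≤ (2/3)(1 + 2^{−ℓ₀})·2ⁿ` inputs,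
every charge `c`. -/
theorem globalJunta_window (ℓ₀ : ℕ) (hℓ₀ : 1 ≤ ℓ₀) (n c : ℕ) (J : Finset (Fin n)) (hJ : 42 * ℓ₀ * (J.card + 1) ≤ n)
    (y : Fin (n + 1) → (Fin n → Bool) → Bool)
    (hy : ∀ g, ∀ u v : Fin n → Bool, (∀ i ∈ J, u i = v i) → y g u = y g v) :
    3 * 2 ^ ℓ₀ * (univ.filter fun u : Fin n → Bool => ringWinU c y u = true).card ≤ (2 * 2 ^ ℓ₀ + 2) * 2 ^ n := by
  set m := 42 * ℓ₀ with hm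
  obtain ⟨j, hj, hjJ⟩ := exists_window_disjoint_len m J
  have hfit : m * j + m ≤ n := by
    have : m * j + m ≤ m * (J.card + 1) := by rw [← Nat.mul_succ]; exact Nat.mul_le_mul_left _ (by omega)
    omega
  have h := gapLaw_window ℓ₀ hℓ₀ n c (m * j) hfit y fun g u v huv => hy g u v fun i hi => huv i (hjJ i hi)
  have h2 : (2 : ℕ) ≤ 2 ^ ℓ₀ := by
    calc (2 : ℕ) = 2 ^ 1 := by norm_num
      _ ≤ 2 ^ ℓ₀ := Nat.pow_le_pow_right (by norm_num) hℓ₀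
  have hsub : 3 * 2 ^ ℓ₀ - (2 ^ ℓ₀ - 2) = 2 * 2 ^ ℓ₀ + 2 := by omega
  rwa [hsub] at h

end TransferWalk

end Summit.QuantumAdvantage.AdviceFreeQNC0

end
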